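import Summits.AtomisticToContinuum.Crystallization.Theorems.HullMinimalityLayeredWindowsCore
import Summits.AtomisticToContinuum.Crystallization.Theorems.SpectralChargeLedgerShellsToLayers
import Summits.AtomisticToContinuum.Crystallization.Theorems.FluxTubeKeplerKeplerEnergyFloor

/-!
# Crux `HullMinimality.LayeredWindows` (stmt-AtomisticToContinuum-11778), line `registered` / `minimal_core`:
# two more by-name DOORS to stub S2' `stub_cleanCoreOfGoodBall` — S2' ⇐ item 17044 `SpectralChargeLedger.SummedShellPricing`
# and S2' ⇐ item 15221 `FluxTubeKepler.FluxCellKepler`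

Stub S2' (clean core of a large all-two-shell-good ball of a Lennard-Jones ground state) is the conclusion of the
landed `cleanCentre_of_goodBall` with its hypothesis `NashNearField` (item 16827) removed.  This file lands a door
from a DIFFERENT energetic input, the summed first-shell pricing K1 of route `SpectralChargeLedger`
(`SummedShellPricing`, stmt-AtomisticToContinuum-17044: at the relaxed Barlow cell `(a₀, h₀)` every tolerance
`τ ∈ (0, 1]` has a price `κ > 0` per `τ`-defective `13/10·a₀`-shell, `κ·#B ≤ E(y) − N e⋆`), through the PROVED
pure-geometry item `ShellsToLayers` (stmt-17254, `ShellsToLayers.shellsToLayers_proof`):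

* `exists_forall_near_of_priced` — counting: if the `¬P`-sites of a `1/3`-separated configuration are priced at
  `κ` each against a budget `b` with `(6R+1)³ b < κ N`, some particle has all particles within `R` of it `P`;
* `exists_card_ge_of_goodBall` — an all-two-shell-good `ρ`-ball holds `≥ ρ/C` particles (relative denseness of good
  regions, `stub_goodRegionDense` + `stub_coverCount`), so large good balls force `N` large;
* `cleanCentre_of_window` — the pointwise core of the landed `cleanCentres_freq_of_layeredWindows`: inside an
  `(|R'| + 6, min (1/200) η)`-window of a `1/3`-separated configuration some particle has its whole `R'`-ball
  crux-`Good` and `LayeredNear η` (the window is its own local template);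
* `stub_cleanCoreOfGoodBall_of_summedShellPricing : SummedShellPricing → S2'` — THE DOOR: the energy budget
  `E(N) ≤ N (e⋆ + θ)` (eventually; `N` is forced large by the good `ρ`-ball) bounds the `τ`-defective shells by
  `θN/κ`, too few `R`-neighbourhoods to cover all particles, so some particle has a `τ`-good `R`-ball, hence an
  `(|R'| + 6, min (1/200) η)`-window (`ShellsToLayers`), hence a clean `R'`-centre.

So S2' ⇐ 17044 (and, through the landed conditional proof of 17044, ⇐ 14476 ∧ 14477), independently of the
near-field programme 13958 ⇒ 16827 ⇒ S2'.  The same counting gives the door from route `FluxTubeKepler`: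
`stub_cleanCoreOfGoodBall_of_fluxCellKepler : FluxCellKepler → S2'` (item 15221, through the PROVED
`KeplerEnergyFloor` 15222, which prices the non-`(R, η)`-layered neighbourhoods of ground states directly).
Both antecedents are GLOBAL coercive inequalities (whole configuration, `E − N e⋆`), so neither needs the boundary
term of the near field, and the all-good `ρ`-ball enters only to force `N` large.  No definitions; S2' is stated
inline exactly as the registered stub.
-/

noncomputable section

open scoped BigOperators Classical InnerProductSpace
open Filter Topology

namespace Summit.AtomisticToContinuum.Crystallization.Theorems.LayeredWindowsLocal

open Summit.AtomisticToContinuum.Crystallization.Theses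
open Summit.AtomisticToContinuum.Crystallization.Theorems.PrestressSplitKorn
open Summit.AtomisticToContinuum.Crystallization.Theorems.DefectFreeCrystallizes.Negative.PredicateAPI (Good)
open Literature.MathematicalPhysics.StatisticalMechanics Literature.Geometry.DiscreteGeometry

-- `E3 = EuclideanSpace ℝ (Fin 3)` as the (reducible) library abbreviation (no notation declared here).
open Summit.AtomisticToContinuum.Crystallization.Theorems.ChargedEnergyGapNegative (E3)

/-! ## Counting: priced bad sites cannot be everywhere -/

/-- **Priced bad sites leave a clear ball.** In a `1/3`-separated configuration of `N` particles, if every set of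
`¬P`-sites `B` satisfies `κ·#B ≤ b` and `(6R + 1)³ b < κ N`, then some particle has every particle within `R` of it
satisfying `P` (the `R`-neighbourhoods of the `¬P`-sites hold at most `(6R+1)³` sites each). -/
theorem exists_forall_near_of_priced {N : ℕ} {x : Fin N → E3}
    (hsep : ∀ i j : Fin N, i ≠ j → (1 / 3 : ℝ) ≤ dist (x i) (x j))
    {P : Fin N → Prop} {R κ b : ℝ} (hR : 0 ≤ R) (hκ : 0 < κ)
    (hprice : ∀ B : Finset (Fin N), (∀ i ∈ B, ¬ P i) → κ * (B.card : ℝ) ≤ b)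
    (hb : (6 * R + 1) ^ 3 * b < κ * N) :
    ∃ i : Fin N, ∀ j : Fin N, dist (x j) (x i) ≤ R → P j := by
  classical
  set D := Finset.univ.filter fun i : Fin N => ¬ P i with hD
  have hDb : κ * (D.card : ℝ) ≤ b := hprice D fun i hi => (Finset.mem_filter.1 hi).2
  set Sp := Finset.univ.filter fun i : Fin N => ∃ j ∈ D, dist (x j) (x i) ≤ R with hSp
  have hSple : (Sp.card : ℝ) ≤ (6 * R + 1) ^ 3 * D.card := by
    have := squeeze_card_filter_exists_near_le (by norm_num : (0 : ℝ) < 1 / 3) hR hsep D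
    calc (Sp.card : ℝ) ≤ (2 * R / (1 / 3) + 1) ^ 3 * (D.card : ℝ) := this
      _ = (6 * R + 1) ^ 3 * D.card := by ring
  have hlt : (Sp.card : ℝ) < N := by
    have h1 : κ * (Sp.card : ℝ) ≤ (6 * R + 1) ^ 3 * (κ * D.card) := by
      calc κ * (Sp.card : ℝ) ≤ κ * ((6 * R + 1) ^ 3 * D.card) := mul_le_mul_of_nonneg_left hSple hκ.le
        _ = (6 * R + 1) ^ 3 * (κ * D.card) := by ring
    have h2 : (6 * R + 1) ^ 3 * (κ * (D.card : ℝ)) ≤ (6 * R + 1) ^ 3 * b :=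
      mul_le_mul_of_nonneg_left hDb (by positivity)
    have h3 : κ * (Sp.card : ℝ) < κ * N := by linarith
    exact lt_of_mul_lt_mul_left h3 hκ.le
  have hcard : Sp.card < (Finset.univ : Finset (Fin N)).card := by
    rw [Finset.card_univ, Fintype.card_fin]
    exact_mod_cast hlt
  obtain ⟨i, -, hi⟩ := Finset.exists_mem_notMem_of_card_lt_card hcard
  refine ⟨i, fun j hj => ?_⟩
  by_contra hPj
  exact hi (Finset.mem_filter.2 ⟨Finset.mem_univ _, j, Finset.mem_filter.2 ⟨Finset.mem_univ _, hPj⟩, hj⟩)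

/-! ## Large all-good balls hold many particles -/

/-- **An all-two-shell-good `ρ`-ball holds at least `ρ/C` particles** (`C = 4r₀` with the denseness radius `r₀` of
`stub_goodRegionDense`): the half ball is covered by `r₀`-balls around particles (`stub_coverCount`), so it holds
`≥ (ρ/(4r₀))³ ≥ ρ/(4r₀)` particles once `ρ ≥ 4r₀`. -/
theorem exists_card_ge_of_goodBall :
    ∃ C : ℝ, 1 ≤ C ∧ ∀ (N : ℕ) (x : Fin N → E3), Function.Injective x → ∀ (i₀ : Fin N) (ρ : ℝ), C ≤ ρ →
      (∀ j : Fin N, dist (x j) (x i₀) ≤ ρ → IsTwoShellGood (1 / 20) (47 / 50) 1 x j) → ρ / C ≤ N := by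
  classical
  obtain ⟨r₀, hr₀1, hdense⟩ := stub_goodRegionDense (2 / 11) (by norm_num) stub_patternCovering
  have hr₀ : 0 < r₀ := by linarith
  refine ⟨4 * r₀, by linarith, fun N x hinj i₀ ρ hρ hgood => ?_⟩
  have hρpos : 0 < ρ := by linarith
  -- adapted from `cleanCentre_of_goodBall` (Theorems/HullMinimalityLayeredWindowsFrequently.lean)
  set T := Finset.univ.filter fun i : Fin N => dist (x i) (x i₀) ≤ ρ / 2 with hT
  have hTcard : (ρ / (4 * r₀)) ^ 3 ≤ (T.card : ℝ) := by
    have hR : 0 ≤ ρ / 2 - r₀ := by linarith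
    have hcov : ∀ y : E3, dist y (x i₀) ≤ ρ / 2 - r₀ →
        ∃ q ∈ Finset.univ.image x, dist q y < r₀ := by
      intro y hy
      obtain ⟨j, hj⟩ := hdense N x i₀ ρ hgood y (by linarith)
      exact ⟨x j, Finset.mem_image_of_mem _ (Finset.mem_univ j), hj⟩
    have hcnt := stub_coverCount r₀ (ρ / 2 - r₀) hr₀ hR (x i₀) (Finset.univ.image x) hcov
    have himg : ((Finset.univ.image x).filter fun q => dist q (x i₀) ≤ ρ / 2 - r₀ + r₀) = T.image x := by
      rw [hT, Finset.filter_image]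
      congr 1
      ext i
      simp
    rw [himg, Finset.card_image_of_injective _ hinj] at hcnt
    have hle : ρ / (4 * r₀) ≤ (ρ / 2 - r₀) / r₀ := by
      rw [div_le_div_iff₀ (by positivity) hr₀]
      nlinarith [mul_le_mul_of_nonneg_right hρ hr₀.le]
    calc (ρ / (4 * r₀)) ^ 3 ≤ ((ρ / 2 - r₀) / r₀) ^ 3 := pow_le_pow_left₀ (by positivity) hle 3
      _ ≤ (T.card : ℝ) := hcnt
  have hb : (1 : ℝ) ≤ ρ / (4 * r₀) := by
    rw [le_div_iff₀ (by positivity)]; linarith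
  have h1 : ρ / (4 * r₀) ≤ (ρ / (4 * r₀)) ^ 3 := by
    calc ρ / (4 * r₀) = (ρ / (4 * r₀)) ^ 1 := (pow_one _).symm
      _ ≤ (ρ / (4 * r₀)) ^ 3 := pow_le_pow_right₀ hb (by norm_num)
  have h2 : (T.card : ℝ) ≤ N := by
    have := Finset.card_le_univ T
    rw [Fintype.card_fin] at this
    exact_mod_cast this
  linarith

/-! ## The pointwise clean centre of a window -/

/-- **Inside a window some particle has a clean `R'`-ball** (pointwise core of the landed
`cleanCentres_freq_of_layeredWindows`). If an injective `1/3`-separated configuration `x` is two-way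
`min (1/200) η`-matched on `B(0, |R'| + 6)`, after the translation `t`, with the rigid image `A ''` of a box template
`layeredPos a s z` (`a ∈ [47/50, 1]`, increments in `[39a/50, 17a/20]`, `IsHaggSeq s`), then some particle has every
particle within `R'` of it crux-`Good` (deep particles of a `1/200`-window are two-shell good,
`isTwoShellGood_of_window`) and `LayeredNear η` (the window read on its radius-`2` ball). -/
theorem cleanCentre_of_window {N : ℕ} {x : Fin N → E3} (hinj : Function.Injective x)
    (hsep : ∀ i j : Fin N, i ≠ j → (1 / 3 : ℝ) ≤ dist (x i) (x j))
    {η : ℝ} (R' : ℝ) {a : ℝ} (ha47 : 47 / 50 ≤ a) (ha1 : a ≤ 1)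
    {A : E3 →ₗᵢ[ℝ] E3} {t : E3} {s : ℤ → ℤ} {z : ℤ → ℝ} (hs : IsHaggSeq s)
    (hz : ∀ m : ℤ, 39 / 50 * a ≤ z (m + 1) - z m ∧ z (m + 1) - z m ≤ 17 / 20 * a)
    (h1 : ∀ p ∈ Set.range (fun l : ℤ × ℤ × ℤ => A (layeredPos a s z l)), ‖p‖ ≤ |R'| + 6 →
      ∃ i : Fin N, dist (x i + t) p ≤ min (1 / 200) η)
    (h2 : ∀ i : Fin N, ‖x i + t‖ ≤ |R'| + 6 →
      ∃ p ∈ Set.range (fun l : ℤ × ℤ × ℤ => A (layeredPos a s z l)), dist (x i + t) p ≤ min (1 / 200) η) :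
    ∃ i : Fin N, ∀ j : Fin N, dist (x j) (x i) ≤ R' → Good x j ∧ LayeredNear η x j := by
  -- adapted from `cleanCentres_freq_of_layeredWindows` (Theorems/HullMinimalityLayeredWindowsNecessity.lean)
  have hbox : InBox a z := ⟨ha47, ha1, hz⟩
  -- the `1/200`-window read off the `min (1/200) η`-window
  have h1' : ∀ p ∈ Set.range (fun l : ℤ × ℤ × ℤ => A (layeredPos a s z l)), ‖p‖ ≤ |R'| + 6 →
      ∃ i : Fin N, dist (x i + t) p ≤ 1 / 200 := fun p hp hpR => by
    obtain ⟨i, hi⟩ := h1 p hp hpR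
    exact ⟨i, hi.trans (min_le_left _ _)⟩
  have h2' : ∀ i : Fin N, ‖x i + t‖ ≤ |R'| + 6 →
      ∃ p ∈ Set.range (fun l : ℤ × ℤ × ℤ => A (layeredPos a s z l)), dist (x i + t) p ≤ 1 / 200 :=
    fun i hi => by
    obtain ⟨p, hp, hd⟩ := h2 i hi
    exact ⟨p, hp, hd.trans (min_le_left _ _)⟩
  -- a particle near the centre of the window
  obtain ⟨l, hl⟩ := exists_site_norm_le_one hbox A (s := s)
  obtain ⟨i₀, hi₀⟩ := h1' _ ⟨l, rfl⟩ (by linarith [abs_nonneg R'])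
  have hi₀n : ‖x i₀ + t‖ ≤ 1 + 1 / 200 := by
    calc ‖x i₀ + t‖ = dist (x i₀ + t) 0 := (dist_zero_right _).symm
      _ ≤ dist (x i₀ + t) (A (layeredPos a s z l)) + dist (A (layeredPos a s z l)) 0 := dist_triangle _ _ _
      _ ≤ 1 / 200 + 1 := by rw [dist_zero_right]; exact add_le_add hi₀ hl
      _ = 1 + 1 / 200 := by ring
  refine ⟨i₀, fun j hj => ?_⟩
  have hjn : ‖x j + t‖ + 2 ≤ |R'| + 6 := by
    have hρ : dist (x j) (x i₀) ≤ |R'| := hj.trans (le_abs_self R')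
    calc ‖x j + t‖ + 2 ≤ (dist (x j + t) (x i₀ + t) + ‖x i₀ + t‖) + 2 := by
          gcongr
          calc ‖x j + t‖ = dist (x j + t) 0 := (dist_zero_right _).symm
            _ ≤ dist (x j + t) (x i₀ + t) + dist (x i₀ + t) 0 := dist_triangle _ _ _
            _ = _ := by rw [dist_zero_right]
      _ = dist (x j) (x i₀) + ‖x i₀ + t‖ + 2 := by rw [dist_add_right]
      _ ≤ |R'| + 6 := by linarith
  constructor
  · exact HullBridgeExact.cc_good_of_isTwoShellGood hinj (isTwoShellGood_of_window hsep hbox hs h1' h2' hjn)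
  · refine ⟨A, t, a, s, z, hbox, hs, ?_⟩
    dsimp only
    constructor
    · intro j' hj'
      have hj'R : ‖x j' + t‖ ≤ |R'| + 6 := by
        calc ‖x j' + t‖ = dist (x j' + t) 0 := (dist_zero_right _).symm
          _ ≤ dist (x j' + t) (x j + t) + dist (x j + t) 0 := dist_triangle _ _ _
          _ = dist (x j') (x j) + ‖x j + t‖ := by rw [dist_add_right, dist_zero_right]
          _ ≤ |R'| + 6 := by linarith
      obtain ⟨p, hp, hd⟩ := h2 j' hj'R
      exact ⟨p, hp, hd.trans (min_le_right _ _)⟩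
    · intro p hp hpj
      have hpR : ‖p‖ ≤ |R'| + 6 := by
        calc ‖p‖ = dist p 0 := (dist_zero_right _).symm
          _ ≤ dist p (x j + t) + dist (x j + t) 0 := dist_triangle _ _ _
          _ = dist p (x j + t) + ‖x j + t‖ := by rw [dist_zero_right]
          _ ≤ |R'| + 6 := by linarith
      obtain ⟨i, hi⟩ := h1 p hp hpR
      exact ⟨i, hi.trans (min_le_right _ _)⟩

/-! ## The door: S2' from the summed first-shell pricing -/

/-- **DOOR: S2' ⇐ item 17044.** `SpectralChargeLedger.SummedShellPricing` (stmt-AtomisticToContinuum-17044) implies stub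
S2' `stub_cleanCoreOfGoodBall` of crux `HullMinimality.LayeredWindows` (stated inline, verbatim): for every `η > 0`
and `R'` there is `ρ` such that in every Lennard-Jones ground state, if every particle within `ρ` of `y i₀` is
two-shell good, then some particle has its whole `R'`-ball `Good` and `LayeredNear η`.  Proof: at the cell
`(a₀, h₀)` of K1 (`δ = 1/3`, the separation of ground states) take `(τ, R)` from the PROVED `ShellsToLayers` at scale
`(|R'| + 6, min (1/200) η)` and the price `κ(τ)`; with `θ = κ / (2(6R+1)³)` the budget `E(N) ≤ N(e⋆ + θ)` holds for
`N ≥ N₀` (`energy_budget_eventually`), and `N ≥ N₀` is forced by the good `ρ`-ball (`exists_card_ge_of_goodBall`);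
so the `τ`-defective shells number `≤ θN/κ`, some particle has a `τ`-good `R`-ball (`exists_forall_near_of_priced`),
hence a window (`ShellsToLayers`), hence a clean `R'`-centre (`cleanCentre_of_window`). -/
theorem stub_cleanCoreOfGoodBall_of_summedShellPricing
    (hK1 : Summit.AtomisticToContinuum.Crystallization.Theses.SpectralChargeLedger.SummedShellPricing) :
    ∀ η : ℝ, 0 < η → ∀ R' : ℝ, ∃ ρ : ℝ, ∀ (N : ℕ) (y : Fin N → E3), IsGroundState lennardJones y →
      ∀ i₀ : Fin N, (∀ j : Fin N, dist (y j) (y i₀) ≤ ρ → IsTwoShellGood (1 / 20) (47 / 50) 1 y j) →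
        ∃ i : Fin N, ∀ j : Fin N, dist (y j) (y i) ≤ R' → Good y j ∧ LayeredNear η y j := by
  intro η hη R'
  classical
  -- the cell of K1 at the separation `1/3` of ground states
  obtain ⟨a₀, h₀, ha47, ha1, hh, hτκ⟩ := hK1 (1 / 3) (by norm_num)
  -- shells to layers at scale `(|R'| + 6, min (1/200) η)`
  have hε : (0 : ℝ) < min (1 / 200) η := lt_min (by norm_num) hη
  obtain ⟨τ, R, hτ0, hτ1, hSL⟩ :=
    ShellsToLayers.shellsToLayers_proof a₀ h₀ ha47 ha1 hh (1 / 3) (by norm_num) (|R'| + 6) (min (1 / 200) η) hε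
  -- the price of a `τ`-defective shell
  obtain ⟨κ, hκ, hprice⟩ := hτκ τ hτ0 hτ1
  set R₁ : ℝ := max R 0 with hR₁
  have hR₁0 : 0 ≤ R₁ := le_max_right _ _
  have hRR₁ : R ≤ R₁ := le_max_left _ _
  have hK : 0 < (6 * R₁ + 1) ^ 3 := by positivity
  set θ : ℝ := κ / (2 * (6 * R₁ + 1) ^ 3) with hθ
  have hθ0 : 0 < θ := by positivity
  obtain ⟨N₀, hN₀⟩ := energy_budget_eventually hθ0
  obtain ⟨C, hC1, hcard⟩ := exists_card_ge_of_goodBall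
  have hC0 : 0 < C := by linarith
  refine ⟨C * ((N₀ : ℝ) + 1), fun N y hy i₀ hi₀ => ?_⟩
  have hinj : Function.Injective y := hy.1
  have hsep : ∀ i j : Fin N, i ≠ j → (1 / 3 : ℝ) ≤ dist (y i) (y j) := fun i j hij =>
    ZeroDefectDensity.third_le_dist_of_isGroundState hy hij
  -- `N ≥ N₀ + 1`, forced by the good ball
  have hN₀N : (N₀ : ℝ) + 1 ≤ N := by
    have hρC : C ≤ C * ((N₀ : ℝ) + 1) := by
      have : (1 : ℝ) ≤ (N₀ : ℝ) + 1 := by linarith [(Nat.cast_nonneg N₀ : (0 : ℝ) ≤ N₀)]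
      nlinarith
    have := hcard N y hinj i₀ (C * ((N₀ : ℝ) + 1)) hρC hi₀
    rwa [mul_div_cancel_left₀ _ hC0.ne'] at this
  have hN₀le : N₀ ≤ N := by
    have : (N₀ : ℝ) ≤ N := by linarith
    exact_mod_cast this
  have hNpos : (0 : ℝ) < N := by linarith [(Nat.cast_nonneg N₀ : (0 : ℝ) ≤ N₀)]
  -- the energy budget of the ground state
  set e : ℝ := ⨅ Q : PeriodicConfiguration 3, Q.energyPerParticle lennardJones with he
  have hE : interactionEnergy lennardJones y - (N : ℝ) * e ≤ (N : ℝ) * θ := by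
    have h1 := hN₀ N hN₀le
    rw [← hy.2, mul_add] at h1
    linarith
  -- a particle with a `τ`-good `R₁`-ball
  have hb : (6 * R₁ + 1) ^ 3 * (interactionEnergy lennardJones y - (N : ℝ) * e) < κ * N := by
    have h1 : (6 * R₁ + 1) ^ 3 * (interactionEnergy lennardJones y - (N : ℝ) * e) ≤
        (6 * R₁ + 1) ^ 3 * ((N : ℝ) * θ) := mul_le_mul_of_nonneg_left hE hK.le
    have h2 : (6 * R₁ + 1) ^ 3 * ((N : ℝ) * θ) = κ * N / 2 := by
      rw [hθ]; field_simp
    have h3 : κ * N / 2 < κ * N := by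
      have : 0 < κ * N := mul_pos hκ hNpos
      linarith
    linarith
  obtain ⟨i, hi⟩ := exists_forall_near_of_priced hsep hR₁0 hκ (hprice N y hsep) hb
  -- its window
  obtain ⟨A, t, s, z, hs, hz, h12⟩ := hSL N y hsep i fun j hj => hi j (hj.trans hRR₁)
  dsimp only at h12
  rw [← HullBridgeExact.wg_range_layeredPos_eq] at h12
  obtain ⟨h1, h2⟩ := h12
  exact cleanCentre_of_window hinj hsep R' ha47 ha1 hs hz h1 h2

/-! ## A third door: S2' from the flux-cell Kepler inequality -/

/-- **Priced bad sites are not all sites** (subtype-cardinality form): if `c·#{i : ¬P i} ≤ b < c·N` then some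
site satisfies `P` (otherwise the subtype is all of `Fin N`). -/
theorem exists_of_natCard_priced {N : ℕ} {P : Fin N → Prop} {c b : ℝ}
    (h : c * (Nat.card {i : Fin N // ¬ P i} : ℝ) ≤ b) (hb : b < c * N) : ∃ i : Fin N, P i := by
  by_contra hne
  push Not at hne
  have hcN : Nat.card {i : Fin N // ¬ P i} = N := by
    rw [Nat.card_congr (Equiv.subtypeUnivEquiv hne), Nat.card_eq_fintype_card, Fintype.card_fin]
  rw [hcN] at h
  have : c * (N : ℝ) < c * N := h.trans_lt hb
  exact lt_irrefl _ this

/-- **DOOR: S2' ⇐ item 15221.** `FluxTubeKepler.FluxCellKepler` (stmt-AtomisticToContinuum-15221, the flux-cell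
Kepler inequality) implies stub S2' `stub_cleanCoreOfGoodBall` (stated inline, verbatim).  Through the PROVED
`KeplerEnergyFloor` (stmt-15222, `keplerEnergyFloor_proof`, at the proved minimal distance
`LennardJonesMinimalDistance_holds`) it prices, for every `(R, η)`, the particles of a ground state whose
`R`-neighbourhood is not two-way `η`-matched to a layered set by `c(R, η) > 0` each against `E(x) − N e(P₀) ≤
E(x) − N e⋆`; the budget `E(N) ≤ N(e⋆ + c/2)` (for `N ≥ N₀`, forced by the good `ρ`-ball, `exists_card_ge_of_goodBall`)
leaves a particle with an `(|R'| + 6, min (1/200) η)`-layered neighbourhood, i.e. a window centred at it, hence a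
clean `R'`-centre (`cleanCentre_of_window`). -/
theorem stub_cleanCoreOfGoodBall_of_fluxCellKepler
    (hK : Summit.AtomisticToContinuum.Crystallization.Theses.FluxTubeKepler.FluxCellKepler) :
    ∀ η : ℝ, 0 < η → ∀ R' : ℝ, ∃ ρ : ℝ, ∀ (N : ℕ) (y : Fin N → E3), IsGroundState lennardJones y →
      ∀ i₀ : Fin N, (∀ j : Fin N, dist (y j) (y i₀) ≤ ρ → IsTwoShellGood (1 / 20) (47 / 50) 1 y j) →
        ∃ i : Fin N, ∀ j : Fin N, dist (y j) (y i) ≤ R' → Good y j ∧ LayeredNear η y j := by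
  intro η hη R'
  classical
  obtain ⟨P₀, -, hcount⟩ := keplerEnergyFloor_proof hK LennardJonesMinimalDistance_holds
  have hε : (0 : ℝ) < min (1 / 200) η := lt_min (by norm_num) hη
  have hR6 : (0 : ℝ) < |R'| + 6 := by positivity
  obtain ⟨c, hc, hcnt⟩ := hcount (|R'| + 6) (min (1 / 200) η) hR6 hε
  have hθ0 : (0 : ℝ) < c / 2 := by positivity
  obtain ⟨N₀, hN₀⟩ := energy_budget_eventually hθ0
  obtain ⟨C, hC1, hcard⟩ := exists_card_ge_of_goodBall
  have hC0 : 0 < C := by linarith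
  refine ⟨C * ((N₀ : ℝ) + 1), fun N y hy i₀ hi₀ => ?_⟩
  have hinj : Function.Injective y := hy.1
  have hsep : ∀ i j : Fin N, i ≠ j → (1 / 3 : ℝ) ≤ dist (y i) (y j) := fun i j hij =>
    ZeroDefectDensity.third_le_dist_of_isGroundState hy hij
  -- `N ≥ N₀ + 1`, forced by the good ball
  have hN₀N : (N₀ : ℝ) + 1 ≤ N := by
    have hρC : C ≤ C * ((N₀ : ℝ) + 1) := by
      have : (1 : ℝ) ≤ (N₀ : ℝ) + 1 := by linarith [(Nat.cast_nonneg N₀ : (0 : ℝ) ≤ N₀)]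
      nlinarith
    have := hcard N y hinj i₀ (C * ((N₀ : ℝ) + 1)) hρC hi₀
    rwa [mul_div_cancel_left₀ _ hC0.ne'] at this
  have hN₀le : N₀ ≤ N := by
    have : (N₀ : ℝ) ≤ N := by linarith
    exact_mod_cast this
  have hNpos : (0 : ℝ) < N := by linarith [(Nat.cast_nonneg N₀ : (0 : ℝ) ≤ N₀)]
  -- the energy budget of the ground state, against `e(P₀) ≥ e⋆`
  set e : ℝ := ⨅ Q : PeriodicConfiguration 3, Q.energyPerParticle lennardJones with he
  have hE : interactionEnergy lennardJones y - (N : ℝ) * e ≤ (N : ℝ) * (c / 2) := by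
    have h1 := hN₀ N hN₀le
    rw [← hy.2, mul_add] at h1
    linarith
  have heP : e ≤ P₀.energyPerParticle lennardJones :=
    ciInf_le ChargedEnergyGapNegative.bddBelow_energyPerParticle_lennardJones P₀
  have hb : interactionEnergy lennardJones y - (N : ℝ) * P₀.energyPerParticle lennardJones < c * N := by
    have h1 : (N : ℝ) * e ≤ (N : ℝ) * P₀.energyPerParticle lennardJones :=
      mul_le_mul_of_nonneg_left heP hNpos.le
    have h2 : (N : ℝ) * (c / 2) < c * N := by
      have : 0 < c * N := mul_pos hc hNpos
      linarith
    linarith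
  -- a particle with a layered `(|R'| + 6, min (1/200) η)`-neighbourhood
  obtain ⟨i, a, ha47, ha1, A, s, z, hs, hz, h12⟩ := exists_of_natCard_priced (hcnt N y hy) hb
  dsimp only at h12
  rw [← HullBridgeExact.wg_range_layeredPos_eq] at h12
  obtain ⟨h1, h2⟩ := h12
  have hsub : ∀ j : Fin N, y j + -y i = y j - y i := fun j => (sub_eq_add_neg _ _).symm
  refine cleanCentre_of_window hinj hsep R' ha47 ha1 (A := A) (t := -y i) hs hz ?_ ?_
  · intro p hp hpR
    obtain ⟨j, hj⟩ := h1 p hp hpR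
    exact ⟨j, by rwa [hsub]⟩
  · intro j hj
    rw [hsub] at hj
    obtain ⟨p, hp, hd⟩ := h2 j hj
    exact ⟨p, hp, by rwa [hsub]⟩

end Summit.AtomisticToContinuum.Crystallization.Theorems.LayeredWindowsLocal

end
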